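import Summits.Ventures.Crystal3D.Theorems.StickyWulffConstantTextureLiminfFluxChart
import HarnessLib

/-!
# Flux count F2: the weighted parameter length of one zigzag line in a unit slice is at most one, and an integral over
# the lines supported on finitely many lattice cells is at most the number of cells
# (lane T, the T-side port of lane G's walker ledger — flux count; crux `TextureLiminf`, stmt-Ventures-19483)

HONEST FRAMING. Venture `Summits/Ventures/Crystal3D` (cell `crystal3d-full`), helper `--supports` the crux
`TextureLiminf` (stmt-Ventures-19483) of `route-Ventures-StickyWulffConstant`, registered line `TexShadow` (v6.6; cf-p1
ROUTE.md §86(42) AK: flux count of the per-top walker families, owner wulff-p2).  Rung credit only; F-C1 not moved.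
Pure measure theory in model coordinates; nothing about packings.

With `…TextureLiminfFluxChart` (`|S ∩ slab_k| = (√3/2)D₂·∫⁻_x ℓ_k(x)`, `ℓ_k(x)` the parameter length the line `x` spends in `S`
inside bilayer `k`) the strip-weighted volume `Σ_k √2·r_k·|S ∩ slab_k|` of a slice `S` becomes `∫⁻_x G(x)`,
`G(x) = Σ_k r_k ℓ_k(x)`, `r_k = ⟪Γ(k+1) − Γ k, ν⟫` the rise of step `k` along the cell vertical `ν`.  This file bounds
that integral by a LINE COUNT:

* `weighted_length_le_one` — if `S` lies in a unit-height slice `{z₁ ≤ ⟪w,ν⟫ ≤ z₁+1}` and every rise is positive, then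
  `G(x) ≤ 1` for every line `x` (the height intervals `(a_k, a_{k+1})` of consecutive steps are disjoint, and step `k`
  contributes at most `|[z₁, z₁+1] ∩ (a_k, a_{k+1})|`);
* `lintegral_le_card_of_floor_mem` — if `G ≤ 1` and `G(x) ≠ 0` only when the lattice cell `⌊x⌋` of `x` belongs to a
  finite set `Good ⊆ ℤ²`, then `∫⁻ G ≤ #Good` (unit cells have volume one).
So `Σ_k √2 r_k |S ∩ slab_k| ≤ #{lattice lines whose unit cell carries a line meeting S}`; the drift lemma and the
assembly with the plate (`…FluxCount`) turn the right-hand side into the number of zigzag lines with a site in the plate.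
WHAT THIS IS NOT: not the flux count itself; F-C1 not moved.
-/

noncomputable section

namespace Summit.Ventures.Crystal3D.Theorems

open MeasureTheory Set
open scoped ENNReal InnerProductSpace
open Literature.MathematicalPhysics.StatisticalMechanics (triangularVec₁ triangularVec₂)
open Summit.Ventures.Crystal3D.Cruxes.TextureLiminf.TexShadow (E3)

/-! ## One line in a unit slice: weighted length at most one -/

/-- The height of the split chart is affine in the parameter: `⟪zigChart' Γk D (τ, x), ν⟫ = ⟪zigChart' Γk D (0, x), ν⟫ + τ⟪D, ν⟫`. -/
theorem inner_zigChart'_eq (Γk D ν : E3) (τ : ℝ) (x : Fin 2 → ℝ) :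
    ⟪zigChart' Γk D (τ, x), ν⟫_ℝ = ⟪zigChart' Γk D (0, x), ν⟫_ℝ + τ * ⟪D, ν⟫_ℝ := by
  simp only [zigChart', zero_smul, add_zero, inner_add_left, inner_smul_left, RCLike.conj_to_real]
  ring

/-- Consecutive base heights differ by the rise: with `D k = Γ (k+1) − Γ k`,
`⟪zigChart' (Γ (k+1)) _ (0, x), ν⟫ = ⟪zigChart' (Γ k) _ (0, x), ν⟫ + ⟪Γ (k+1) − Γ k, ν⟫`. -/
theorem inner_zigChart'_succ (Γ : ℤ → E3) (ν : E3) (x : Fin 2 → ℝ) (k : ℤ) (D D' : E3) :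
    ⟪zigChart' (Γ (k + 1)) D' (0, x), ν⟫_ℝ = ⟪zigChart' (Γ k) D (0, x), ν⟫_ℝ + ⟪Γ (k + 1) - Γ k, ν⟫_ℝ := by
  simp only [zigChart', zero_smul, add_zero, inner_add_left, inner_sub_left]
  ring

/-- **Weighted length at most one.**  See the module docstring. -/
theorem weighted_length_le_one (ν : E3) (Γ : ℤ → E3) (z₁ : ℝ) (x : Fin 2 → ℝ) (S : Set E3)
    (hS : S ⊆ {w : E3 | z₁ ≤ ⟪w, ν⟫_ℝ ∧ ⟪w, ν⟫_ℝ ≤ z₁ + 1})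
    (hr : ∀ k : ℤ, 0 < ⟪Γ (k + 1) - Γ k, ν⟫_ℝ) :
    ∑' k : ℤ, ENNReal.ofReal ⟪Γ (k + 1) - Γ k, ν⟫_ℝ *
        volume {τ : ℝ | zigChart' (Γ k) (Γ (k + 1) - Γ k) (τ, x) ∈ S ∧ 0 < τ ∧ τ < 1} ≤ 1 := by
  -- base heights and rises
  set a : ℤ → ℝ := fun k => ⟪zigChart' (Γ k) (Γ (k + 1) - Γ k) (0, x), ν⟫_ℝ with ha
  set r : ℤ → ℝ := fun k => ⟪Γ (k + 1) - Γ k, ν⟫_ℝ with hrdef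
  have hsucc : ∀ k, a (k + 1) = a k + r k := fun k => by
    simp only [ha, hrdef]
    exact inner_zigChart'_succ Γ ν x k (Γ (k + 1) - Γ k) (Γ (k + 1 + 1) - Γ (k + 1))
  have hmono : StrictMono a := strictMono_int_of_lt_succ fun k => by rw [hsucc]; linarith [hr k]
  set I : Set ℝ := Icc z₁ (z₁ + 1) with hI
  -- step `k` contributes at most the length of `I ∩ (a k, a (k+1))`
  have hstep : ∀ k, ENNReal.ofReal (r k) * volume {τ : ℝ | zigChart' (Γ k) (Γ (k + 1) - Γ k) (τ, x) ∈ S ∧ 0 < τ ∧ τ < 1} ≤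
      volume (I ∩ Ioo (a k) (a (k + 1))) := by
    intro k
    have hrk : 0 < r k := hr k
    have hsub : {τ : ℝ | zigChart' (Γ k) (Γ (k + 1) - Γ k) (τ, x) ∈ S ∧ 0 < τ ∧ τ < 1} ⊆
        (fun τ => r k * τ) ⁻¹' ((fun t => a k + t) ⁻¹' (I ∩ Ioo (a k) (a (k + 1)))) := by
      rintro τ ⟨hτS, h0, h1⟩
      obtain ⟨hz1, hz2⟩ := hS hτS
      rw [inner_zigChart'_eq] at hz1 hz2
      simp only [Set.mem_preimage, Set.mem_inter_iff, hI, Set.mem_Icc, Set.mem_Ioo, hsucc k]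
      refine ⟨⟨?_, ?_⟩, ?_, ?_⟩
      · simp only [ha, hrdef]; linarith [mul_comm τ ⟪Γ (k + 1) - Γ k, ν⟫_ℝ]
      · simp only [ha, hrdef]; linarith [mul_comm τ ⟪Γ (k + 1) - Γ k, ν⟫_ℝ]
      · have := mul_pos hrk h0; linarith
      · have := mul_lt_mul_of_pos_left h1 hrk; linarith
    calc ENNReal.ofReal (r k) * volume {τ : ℝ | zigChart' (Γ k) (Γ (k + 1) - Γ k) (τ, x) ∈ S ∧ 0 < τ ∧ τ < 1}
        ≤ ENNReal.ofReal (r k) * volume ((fun τ => r k * τ) ⁻¹' ((fun t => a k + t) ⁻¹' (I ∩ Ioo (a k) (a (k + 1))))) :=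
          mul_le_mul_right (measure_mono hsub) _
      _ = volume (I ∩ Ioo (a k) (a (k + 1))) := by
          rw [Real.volume_preimage_mul_left hrk.ne', measure_preimage_add, ← mul_assoc, ← ENNReal.ofReal_mul hrk.le,
            abs_of_pos (inv_pos.2 hrk), mul_inv_cancel₀ hrk.ne', ENNReal.ofReal_one, one_mul]
  -- the intervals are pairwise disjoint, inside `I`
  have hdisj : Pairwise fun k k' : ℤ => Disjoint (I ∩ Ioo (a k) (a (k + 1))) (I ∩ Ioo (a k') (a (k' + 1))) := by
    intro k k' hkk
    refine Disjoint.mono Set.inter_subset_right Set.inter_subset_right ?_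
    rw [Set.disjoint_left]
    intro t ht ht'
    rcases lt_or_gt_of_ne hkk with h | h
    · have : a (k + 1) ≤ a k' := hmono.monotone (by omega)
      exact absurd (ht.2.trans_le this) (not_lt.2 ht'.1.le)
    · have : a (k' + 1) ≤ a k := hmono.monotone (by omega)
      exact absurd (ht'.2.trans_le this) (not_lt.2 ht.1.le)
  calc ∑' k : ℤ, ENNReal.ofReal (r k) * volume {τ : ℝ | zigChart' (Γ k) (Γ (k + 1) - Γ k) (τ, x) ∈ S ∧ 0 < τ ∧ τ < 1}
      ≤ ∑' k : ℤ, volume (I ∩ Ioo (a k) (a (k + 1))) := ENNReal.tsum_le_tsum hstep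
    _ = volume (⋃ k : ℤ, I ∩ Ioo (a k) (a (k + 1))) :=
        (measure_iUnion hdisj fun k => measurableSet_Icc.inter measurableSet_Ioo).symm
    _ ≤ volume I := measure_mono (Set.iUnion_subset fun k => Set.inter_subset_left)
    _ = 1 := by rw [hI, Real.volume_Icc]; simp

/-! ## Lattice cells: an integral supported on finitely many unit cells -/

/-- The unit cell of the lattice point `t ∈ ℤ²`. -/
def zigCell (t : Fin 2 → ℤ) : Set (Fin 2 → ℝ) := Set.pi Set.univ fun i => Ico (t i : ℝ) ((t i : ℝ) + 1)

/-- A unit cell has volume one. -/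
theorem volume_zigCell (t : Fin 2 → ℤ) : volume (zigCell t) = 1 := by
  rw [zigCell, Real.volume_pi_Ico]
  simp

/-- Every point lies in the cell of its floor. -/
theorem mem_zigCell_floor (x : Fin 2 → ℝ) : x ∈ zigCell fun i => ⌊x i⌋ := by
  simp only [zigCell, Set.mem_pi, Set.mem_univ, Set.mem_Ico, forall_true_left]
  exact fun i => ⟨Int.floor_le _, Int.lt_floor_add_one _⟩

/-- The cells are measurable. -/
theorem measurableSet_zigCell (t : Fin 2 → ℤ) : MeasurableSet (zigCell t) :=
  MeasurableSet.univ_pi fun _ => measurableSet_Ico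

/-- **An integrand bounded by one and supported on the cells of a finite set of lattice points has integral at most the
number of points.** -/
theorem lintegral_le_card_of_floor_mem (G : (Fin 2 → ℝ) → ℝ≥0∞) (Good : Finset (Fin 2 → ℤ))
    (hG1 : ∀ x, G x ≤ 1) (hG0 : ∀ x, G x ≠ 0 → (fun i => ⌊x i⌋) ∈ Good) :
    ∫⁻ x, G x ≤ (Good.card : ℝ≥0∞) := by
  classical
  set U : Set (Fin 2 → ℝ) := ⋃ t ∈ Good, zigCell t with hU
  have hUmeas : MeasurableSet U := MeasurableSet.biUnion Good.countable_toSet fun t _ => measurableSet_zigCell t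
  have hle : ∀ x, G x ≤ U.indicator 1 x := by
    intro x
    by_cases hx : G x = 0
    · rw [hx]; exact zero_le
    · have hmem : x ∈ U := by
        rw [hU, Set.mem_iUnion₂]
        exact ⟨_, hG0 x hx, mem_zigCell_floor x⟩
      rw [Set.indicator_of_mem hmem]
      exact hG1 x
  calc ∫⁻ x, G x ≤ ∫⁻ x, U.indicator 1 x := lintegral_mono hle
    _ = volume U := lintegral_indicator_one hUmeas
    _ ≤ ∑ t ∈ Good, volume (zigCell t) := measure_biUnion_finset_le Good zigCell
    _ = (Good.card : ℝ≥0∞) := by simp [volume_zigCell]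

end Summit.Ventures.Crystal3D.Theorems

end
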